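import Mathlib
import Summits.NavierStokesRegularity.NavierStokesRegularity.Theorems.SubOnsagerCeilingDyadicWeightedChain
import Summits.NavierStokesRegularity.NavierStokesRegularity.Theorems.SubcriticalEnvelopeForwardSourceTailEnvelopeKPPerm
import HarnessLib

/-!
# KP permutation networks with NON-UNIFORM live weights: a ν-uniform shell barrier from a COMPANION WEIGHT `S` on the modes
# (helper file for crux stmt-NavierStokesRegularity-27057 `SubOnsagerCeiling.ForwardTailCeilingKP`, `--supports`; sequel of
# `SubOnsagerCeilingDyadicWeightedChain` and of LEAD SE's strand files for `kpPermTable`)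

RUNG 6 of the LEAD skeleton (`rung_kpPerm`) needs the feed weights `c` of `kpPermTable σ c` CONSTANT on every `σ`-orbit: then each
strand is a scaled dyadic chain.  With non-constant weights a strand is a chain with PERIODIC bond weights `w_n = c(σⁿa₀)` (LEAD SE's
`quadTerm_kpPerm_phase`), «no barrier for non-constant periodic chains is in the tree».  `DyadicRange.chain_shellBarrier_weighted`
(p816233) is such a barrier once a balanced companion sequence is given; on a permutation network the companion is a WEIGHT ON THE
MODES `S : Fin 4 → ℝ_{>0}` with the per-mode balance `c(σm)·S(m)² = c(m)·S(σm)·S(σ²m)` and the per-mode window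
`p²·c(m)S(σ²m)·b^θ ≤ c(σm)S(σm)·b^{5/2}` (`p = b^{5/2}/(b^θ)³ ≥ 42/25`, `b = 1+ε₀`): along the strand of `a₀` the sequence
`σ_n = S(σⁿa₀)/S(a₀)` is a companion.  A balanced `S` ALWAYS exists on a cycle (2-cycle: `S₁/S₀ = c₁/c₀`; 3-cycle `a→b→c`:
`S_b/S_a = (c_b²/(c_ac_c))^{1/3}`, …), so the only restriction is the window — mild non-uniformity of the weights.

* `kpPermWeighted_shellBarrier` — for `c > 0` everywhere and such an `S` (bounds `S_min ≤ S ≤ S_max`): along every honest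
  non-negative `ν`-viscous solution of `kpPermTable σ c` from a one-shell datum,
  `(1+ε₀)^{2θk}·½X_{i,k}(t)² ≤ 100·(S_max/S_min)²·Σ_j ½(X₀)_j²` for every mode, shell, time — uniformly in `ν`;
* `kpPermWeighted_shellBarrierAt`, `kpPermWeighted_ceilingAt` — the skeleton binder shapes (`θ > 1/2`), composable with the LEAD's
  `fwdCeilingKPAt_of_ceilingAt` into a `by_cases` corner of `ForwardTailCeilingKP_of` next to RUNG 6.

HONEST FRAMING: MODEL lattice ODEs (route SubOnsagerCeiling, rung TL-M2Break); a corner of the registered stub `stub_primaryGradedLargeRatio`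
(all-live permutation networks with mildly non-uniform weights at large ratios), not the stubs; nothing here bears on Navier–Stokes
regularity and no stub, crux or summit is proved. [cite: BarbatoMorandinRomito2011, §2 Lemma 2.1, §3.2] [cite: Tao2016AveragedNS, §4 (4.5), (4.13)]
-/

noncomputable section

-- the sub-problem namespace `NavierStokesRegularity.NavierStokesRegularity` is the tree's layout (D-0017)
set_option linter.dupNamespace false

namespace Summit.NavierStokesRegularity.NavierStokesRegularity.Theorems

open Set
open Literature.Analysis.FluidPDE.TaoCascade
open Summit.NavierStokesRegularity.NavierStokesRegularity.Theorems.SubOnsagerCeiling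
open Summit.NavierStokesRegularity.NavierStokesRegularity.Theses

/-- Two shells up the strand moves along `σ²`. [this file] -/
theorem permPhase_succ_succ (σ : Equiv.Perm (Fin 4)) (a₀ : Fin 4) (k : ℤ) :
    permPhase σ a₀ (k + 2) = σ (σ (permPhase σ a₀ k)) := by
  rw [show k + 2 = (k + 1) + 1 by ring, permPhase_succ, permPhase_succ]

/-- **ν-UNIFORM SHELL BARRIER FOR PERMUTATION NETWORKS WITH NON-UNIFORM LIVE WEIGHTS AND A BALANCED COMPANION WEIGHT**
(see the module docstring). MODEL lattice statement. [cite: BarbatoMorandinRomito2011, §2 Lemma 2.1 and §3.2] -/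
theorem kpPermWeighted_shellBarrier (σ : Equiv.Perm (Fin 4)) {c S : Fin 4 → ℝ} {ε₀ θ Smin Smax : ℝ}
    (hc : ∀ a, 0 < c a) (hS : ∀ a, 0 < S a) (hSmin : 0 < Smin) (hSlo : ∀ a, Smin ≤ S a) (hShi : ∀ a, S a ≤ Smax)
    (hε : 0 < ε₀) (hε1 : ε₀ ≤ 1) (hθ10 : θ < 10) (hp : 42 / 25 ≤ (1 + ε₀) ^ ((5 : ℝ) / 2) / ((1 + ε₀) ^ θ) ^ 3)
    (hbal : ∀ m, c (σ m) * S m ^ 2 = c m * S (σ m) * S (σ (σ m)))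
    (hwin : ∀ m, ((1 + ε₀) ^ ((5 : ℝ) / 2) / ((1 + ε₀) ^ θ) ^ 3) ^ 2 * (c m * S (σ (σ m))) * (1 + ε₀) ^ θ ≤
      (c (σ m) * S (σ m)) * (1 + ε₀) ^ ((5 : ℝ) / 2)) :
    ∀ ν : ℝ, 0 < ν → ∀ (X₀ : Fin 4 → ℝ) (s : ℝ), 0 < s → ∀ X : Fin 4 → ℤ → ℝ → ℝ,
      (∀ (i : Fin 4) (k : ℤ), X i k 0 = if k = 0 then X₀ i else 0) →
      (∀ (i : Fin 4) (k : ℤ), k < 0 → ∀ t : ℝ, X i k t = 0) →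
      (∃ M : ℝ, ∀ (t : ℝ) (i : Fin 4) (k : ℤ), (1 + (1 + ε₀) ^ ((10 : ℝ) * k)) * |X i k t| ≤ M) →
      (∀ (i : Fin 4) (k : ℤ), Continuous (X i k)) →
      (∀ (i : Fin 4) (k : ℤ), ∀ t ∈ Set.Icc (0 : ℝ) s, HasDerivWithinAt (X i k)
        (quadTerm ε₀ (kpPermTable σ c) X i k t - ν * (1 + ε₀) ^ ((2 : ℝ) * k) * X i k t)
        (Set.Icc (0 : ℝ) s) t) →
      (∀ t ∈ Set.Icc (0 : ℝ) s, ∀ (i : Fin 4) (k : ℤ), 1 ≤ k → 0 ≤ X i k t) →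
      ∀ t ∈ Set.Icc (0 : ℝ) s, ∀ (i : Fin 4) (k : ℕ),
        (1 + ε₀) ^ (2 * θ * (k : ℝ)) * ((1 / 2 : ℝ) * X i (k : ℤ) t ^ 2) ≤
          100 * (Smax / Smin) ^ 2 * (∑ j : Fin 4, (1 / 2 : ℝ) * X₀ j ^ 2) := by
  intro ν hν X₀ s hs X hinit hlow hbd hcont hder hnn t ht i k
  set b : ℝ := 1 + ε₀ with hb
  have hb1 : 1 ≤ b := by rw [hb]; linarith
  have hb2 : b ≤ 2 := by rw [hb]; linarith
  have hb0 : 0 < b := by linarith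
  set E₀ : ℝ := ∑ j : Fin 4, (1 / 2 : ℝ) * X₀ j ^ 2 with hE₀
  have hE₀i : ∀ j : Fin 4, (1 / 2 : ℝ) * X₀ j ^ 2 ≤ E₀ := fun j =>
    Finset.single_le_sum (f := fun j => (1 / 2 : ℝ) * X₀ j ^ 2) (fun j _ => by positivity) (Finset.mem_univ j)
  have hSmax0 : 0 < Smax := lt_of_lt_of_le (hS 0) (hShi 0)
  set D : ℝ := 100 * (Smax / Smin) ^ 2 with hD
  have hD0 : 0 ≤ D := by positivity
  -- the strand through `(i, k)`
  set a₀ : Fin 4 := permPhase σ i (-(k : ℤ)) with ha₀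
  set w : ℕ → ℝ := fun n => c (permPhase σ a₀ n) with hw
  set σc : ℕ → ℝ := fun n => S (permPhase σ a₀ n) / S a₀ with hσcdef
  have hwpos : ∀ n, 0 < w n := fun n => hc _
  have hσcpos : ∀ n, 0 < σc n := fun n => div_pos (hS _) (hS _)
  have hσc0 : σc 0 = 1 := by
    simp only [hσcdef, Nat.cast_zero]
    rw [permPhase_zero]; exact div_self (hS a₀).ne'
  set σmin : ℝ := Smin / Smax with hσmin
  set σmax : ℝ := Smax / Smin with hσmax
  have hσmin0 : 0 < σmin := div_pos hSmin hSmax0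
  have hσlo : ∀ n, σmin ≤ σc n := fun n => by
    simp only [hσcdef, hσmin]
    exact div_le_div₀ (le_trans hSmin.le (hSlo _)) (hSlo _) (hS a₀) (hShi a₀)
  have hσhi : ∀ n, σc n ≤ σmax := fun n => by
    simp only [hσcdef, hσmax]
    exact div_le_div₀ hSmax0.le (hShi _) hSmin (hSlo a₀)
  have hcast1 : ∀ n : ℕ, (((n + 1 : ℕ) : ℤ)) = (n : ℤ) + 1 := fun n => by push_cast; ring
  have hcast2 : ∀ n : ℕ, (((n + 2 : ℕ) : ℤ)) = (n : ℤ) + 2 := fun n => by push_cast; ring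
  have hbalσ : ∀ n, w (n + 1) * σc n ^ 2 = w n * σc (n + 1) * σc (n + 2) := fun n => by
    simp only [hw, hσcdef]
    rw [hcast2 n, hcast1 n, permPhase_succ, permPhase_succ_succ]
    have hS0 : S a₀ ≠ 0 := (hS a₀).ne'
    have h := hbal (permPhase σ a₀ n)
    field_simp
    linear_combination h
  have hwinσ : ∀ n, ((1 + ε₀) ^ ((5 : ℝ) / 2) / ((1 + ε₀) ^ θ) ^ 3) ^ 2 * (w n * σc (n + 2)) * (1 + ε₀) ^ θ ≤
      (w (n + 1) * σc (n + 1)) * (1 + ε₀) ^ ((5 : ℝ) / 2) := fun n => by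
    simp only [hw, hσcdef]
    rw [hcast2 n, hcast1 n, permPhase_succ, permPhase_succ_succ]
    have hS0 : 0 < S a₀ := hS a₀
    have h := div_le_div_of_nonneg_right (hwin (permPhase σ a₀ n)) hS0.le
    have e1 : ((1 + ε₀) ^ ((5 : ℝ) / 2) / ((1 + ε₀) ^ θ) ^ 3) ^ 2 *
        (c (permPhase σ a₀ ↑n) * S (σ (σ (permPhase σ a₀ ↑n)))) * (1 + ε₀) ^ θ / S a₀ =
        ((1 + ε₀) ^ ((5 : ℝ) / 2) / ((1 + ε₀) ^ θ) ^ 3) ^ 2 *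
        (c (permPhase σ a₀ ↑n) * (S (σ (σ (permPhase σ a₀ ↑n))) / S a₀)) * (1 + ε₀) ^ θ := by
      field_simp
    have e2 : c (σ (permPhase σ a₀ ↑n)) * S (σ (permPhase σ a₀ ↑n)) * (1 + ε₀) ^ ((5 : ℝ) / 2) / S a₀ =
        c (σ (permPhase σ a₀ ↑n)) * (S (σ (permPhase σ a₀ ↑n)) / S a₀) * (1 + ε₀) ^ ((5 : ℝ) / 2) := by
      field_simp
    rw [e1, e2] at h
    exact h
  -- the strand as a scalar chain
  set Z : ℤ → ℝ → ℝ := fun m τ => X (permPhase σ a₀ m) m τ with hZ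
  have hdat' : ∀ m : ℤ, Z m 0 = if m = 0 then X₀ a₀ else 0 := by
    intro m
    simp only [hZ]
    rw [hinit]
    by_cases hm : m = 0
    · subst hm; simp [permPhase_zero]
    · simp [hm]
  have hvan' : ∀ τ, Z (-1) τ = 0 := fun τ => hlow _ (-1) (by norm_num) τ
  have hbdd' : ∃ M : ℝ, ∀ (τ : ℝ) (m : ℕ), (1 + b ^ ((10 : ℝ) * m)) * |Z m τ| ≤ M := by
    obtain ⟨M, hM⟩ := hbd
    exact ⟨M, fun τ m => by simpa [hZ] using hM τ (permPhase σ a₀ m) m⟩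
  have hcont' : ∀ m : ℕ, ContinuousOn (Z m) (Icc 0 s) := fun m => (hcont (permPhase σ a₀ m) m).continuousOn
  have hnn' : ∀ τ ∈ Icc 0 s, ∀ m : ℕ, 1 ≤ m → 0 ≤ Z m τ := fun τ hτ m hm =>
    hnn τ hτ (permPhase σ a₀ m) m (by exact_mod_cast hm)
  have hode' : ∀ m : ℕ, ∀ τ ∈ Icc 0 s, HasDerivWithinAt (Z m)
      (w (m - 1) * b ^ ((5 : ℝ) * ((m : ℝ) - 1) / 2) * Z ((m : ℤ) - 1) τ ^ 2 -
          w m * b ^ ((5 : ℝ) * (m : ℝ) / 2) * (Z m τ * Z ((m : ℤ) + 1) τ) -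
        ν * b ^ ((2 : ℝ) * (m : ℝ)) * Z m τ) (Icc 0 s) τ := by
    intro m τ hτ
    have h := hder (permPhase σ a₀ m) m τ hτ
    rw [quadTerm_kpPerm_phase, permStrand_zero, permStrand_zero, permStrand_zero] at h
    have hfun : Z m = X (permPhase σ a₀ m) m := rfl
    rw [hfun]
    refine h.congr_deriv ?_
    simp only [hZ, hw]
    push_cast
    rcases Nat.eq_zero_or_pos m with rfl | hm
    · -- datum shell: both feed terms vanish
      simp only [Nat.cast_zero, zero_sub, hlow _ (-1) (by norm_num) τ]
      ring
    · have ecast : (((m - 1 : ℕ) : ℤ)) = (m : ℤ) - 1 := by push_cast [Nat.cast_sub hm]; ring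
      rw [ecast]
      ring
  have key := DyadicRange.chain_shellBarrier_weighted hb1 hb2 hθ10 hp hwpos hσcpos hσc0 hσmin0 hσlo hσhi
    hbalσ hwinσ hν hs hdat' hvan' hbdd' hcont' hode' hnn' t ht k
  have hpow : b ^ (2 * θ * (k : ℝ)) = (b ^ θ) ^ (2 * k) := by
    rw [← Real.rpow_mul_natCast hb0.le]
    congr 1; push_cast; ring
  have hDσ : 100 / σmin ^ 2 = D := by
    rw [hD, hσmin, hσmax]
    field_simp
  have hZk : Z (k : ℤ) t = X i (k : ℤ) t := by
    simp only [hZ, ha₀]; rw [permPhase_start]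
  rw [hpow]
  rw [hDσ, hZk] at key
  calc (b ^ θ) ^ (2 * k) * ((1 / 2 : ℝ) * X i (k : ℤ) t ^ 2)
      = (1 / 2 : ℝ) * ((b ^ θ) ^ (2 * k) * X i (k : ℤ) t ^ 2) := by ring
    _ ≤ (1 / 2 : ℝ) * (D * X₀ a₀ ^ 2) := by linarith
    _ = D * ((1 / 2 : ℝ) * X₀ a₀ ^ 2) := by ring
    _ ≤ D * E₀ := mul_le_mul_of_nonneg_left (hE₀i _) hD0

/-- **The skeleton binder shape**: `ShellBarrierAt R ε₀ (kpPermTable σ c)` for all-live weights with a balanced companion inside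
the window, `θ > 1/2`. [this file] -/
theorem kpPermWeighted_shellBarrierAt (σ : Equiv.Perm (Fin 4)) {c S : Fin 4 → ℝ} {ε₀ θ Smin Smax : ℝ}
    (hc : ∀ a, 0 < c a) (hS : ∀ a, 0 < S a) (hSmin : 0 < Smin) (hSlo : ∀ a, Smin ≤ S a) (hShi : ∀ a, S a ≤ Smax)
    (hε : 0 < ε₀) (hε1 : ε₀ ≤ 1) (hθ : 1 / 2 < θ) (hθ10 : θ < 10)
    (hp : 42 / 25 ≤ (1 + ε₀) ^ ((5 : ℝ) / 2) / ((1 + ε₀) ^ θ) ^ 3)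
    (hbal : ∀ m, c (σ m) * S m ^ 2 = c m * S (σ m) * S (σ (σ m)))
    (hwin : ∀ m, ((1 + ε₀) ^ ((5 : ℝ) / 2) / ((1 + ε₀) ^ θ) ^ 3) ^ 2 * (c m * S (σ (σ m))) * (1 + ε₀) ^ θ ≤
      (c (σ m) * S (σ m)) * (1 + ε₀) ^ ((5 : ℝ) / 2)) (R : ℝ) :
    ShellBarrierAt R ε₀ (kpPermTable σ c) := by
  intro _hT _hO
  exact ⟨θ, hθ, 100 * (Smax / Smin) ^ 2, by positivity,
    kpPermWeighted_shellBarrier σ hc hS hSmin hSlo hShi hε hε1 hθ10 hp hbal hwin⟩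

/-- **Tail ceiling for permutation networks with non-uniform live weights inside the window.** [this file] -/
theorem kpPermWeighted_ceilingAt (σ : Equiv.Perm (Fin 4)) {c S : Fin 4 → ℝ} {ε₀ θ Smin Smax : ℝ}
    (hc : ∀ a, 0 < c a) (hS : ∀ a, 0 < S a) (hSmin : 0 < Smin) (hSlo : ∀ a, Smin ≤ S a) (hShi : ∀ a, S a ≤ Smax)
    (hε : 0 < ε₀) (hε1 : ε₀ ≤ 1) (hθ : 1 / 2 < θ) (hθ10 : θ < 10)
    (hp : 42 / 25 ≤ (1 + ε₀) ^ ((5 : ℝ) / 2) / ((1 + ε₀) ^ θ) ^ 3)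
    (hbal : ∀ m, c (σ m) * S m ^ 2 = c m * S (σ m) * S (σ (σ m)))
    (hwin : ∀ m, ((1 + ε₀) ^ ((5 : ℝ) / 2) / ((1 + ε₀) ^ θ) ^ 3) ^ 2 * (c m * S (σ (σ m))) * (1 + ε₀) ^ θ ≤
      (c (σ m) * S (σ m)) * (1 + ε₀) ^ ((5 : ℝ) / 2)) (R : ℝ) :
    CeilingAt R ε₀ (kpPermTable σ c) :=
  subOnsagerCeiling_ceilingAt_of_shellBarrierAt hε
    (kpPermWeighted_shellBarrierAt σ hc hS hSmin hSlo hShi hε hε1 hθ hθ10 hp hbal hwin R)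

end Summit.NavierStokesRegularity.NavierStokesRegularity.Theorems

end
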